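import Mathlib
import Literature.NumberTheory.Transcendental.KZCalculusProofs
import Literature.NumberTheory.Transcendental.SemialgebraicMapsProofs
import Literature.NumberTheory.Transcendental.KZRelationsLE
import Literature.NumberTheory.Transcendental.KZSubcalculusInvariants
import Summits.KontsevichZagierPeriods.KontsevichZagierPeriods.Theorems.SymplecticScissorsPlanarSAZylevStubTeCalc

/-!
# `VolumeFormOffPlane` (stmt-KontsevichZagierPeriods-14935) — line `Sketch`,
stub `stub_matrixPowerMove` (the integer-matrix power map is one rule-(2) move, `|det| = |det M|`)

Box dimension `n`, total dimension `n + 1`: box coordinates `x_j = p (Fin.castSucc j)`, slack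
`z = p (Fin.last n)`. For `M ∈ ℤ^{n×n}` with `det M ≠ 0` the chart
`Φ_M (x, z) = ((∏_j x_j^{M k j})_k, z · ∏_j x_j / ∏_k ∏_j x_j^{M k j})` is, in logarithmic
coordinates `u = log x`, the linear map `u ↦ M u` (with the slack rescaled so that
`z' ∏ x' = z ∏ x`); hence it is a bijection of the open region `Q = {x_j > 0}` onto itself (inverse
through `M⁻¹` over `ℝ` and `exp`). Its Jacobian matrix is block lower triangular: the box block is
`diag(x') · M · diag(x)⁻¹` and the slack column is `(0, …, 0, ∏ x / ∏ x')`, so (expanding along the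
last column) `det Φ' = det M` is a non-zero CONSTANT. The chart is `ℚ`-semialgebraic (Laurent
monomials are quotients of monomials off the coordinate hyperplanes).

(i) Integrand-`1` representations pull back along `Φ_M`: the pulled-back domain
`{p ∈ Q | Φ_M p ∈ σ'}` is `ℚ`-semialgebraic (Tarski–Seidenberg projection of the graph, the
preimage lemma `PlanarSAZylev.teCalc_isSemialgebraic_preimage` of the sibling crux toolkit) and of
finite volume (`MeasureTheory.integrableOn_image_iff_integrableOn_abs_det_fderiv_smul`).
(ii) Given two integrand-`1` representations `r`, `r'` inside `Q` whose membership is transported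
by `Φ_M`, ONE change of variables (`KZ.changeOfVariablesRel`, rule (2)) links the scaled
representation `|det M| · r` (`KZ.IntegralRep.constMul`) to `r'`, and integrand additivity
(`KZ.IntegralRep.of_constMul_nat_sub_nsmul_mem_relations`, rule (1b)) gives
`[r'] − |det M| • [r] ∈ KZ.relations`.

Sources: M. Kontsevich, D. Zagier, *Periods* (2001), §1.2 rules (1), (2); J. Bochnak, M. Coste,
M.-F. Roy, *Real Algebraic Geometry* (1998), §2.2 (semialgebraic maps, Prop. 2.2.7). The Jacobian
bookkeeping is folklore; the shape of the witness follows the landed siblings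
`…/Theorems/SymplecticScissorsVolumeFormOffPlanePowerMove.lean` (the case `M = diag(i, j)`) and
`…/Theorems/SymplecticScissorsVolumeFormOffPlaneCumprodMove.lean`.
-/

noncomputable section

open MeasureTheory Set MvPolynomial
open Literature.NumberTheory.Transcendental Literature.ModelTheory.ExponentialFields

namespace Summit.KontsevichZagierPeriods.SymplecticScissors.LogPolytope

/-! ## Linear algebra and Laurent monomials -/

/-- Expansion along the last column: if the last column of the matrix of a continuous linear
endomorphism `L` of `ℝⁿ⁺¹` is `(0, …, 0, e)`, then `det L = e · det (box block)`. [folklore] -/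
theorem mpm_det_lastCol {n : ℕ} (L : (Fin (n + 1) → ℝ) →L[ℝ] (Fin (n + 1) → ℝ))
    (h0 : ∀ k : Fin n, L (Pi.single (Fin.last n) 1) (Fin.castSucc k) = 0) :
    L.det = L (Pi.single (Fin.last n) 1) (Fin.last n) *
      (Matrix.of fun k j : Fin n => L (Pi.single (Fin.castSucc j) 1) (Fin.castSucc k)).det := by
  have hentry : ∀ i j, LinearMap.toMatrix' (L : (Fin (n + 1) → ℝ) →ₗ[ℝ] (Fin (n + 1) → ℝ)) i j =
      L (Pi.single j 1) i := fun i j => rfl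
  rw [ContinuousLinearMap.det, ← LinearMap.det_toMatrix', Matrix.det_succ_column _ (Fin.last n),
    Fin.sum_univ_castSucc, Finset.sum_eq_zero, zero_add, hentry, Fin.val_last,
    Even.neg_one_pow ⟨n, rfl⟩, one_mul]
  · congr 2
    ext k j
    simp only [Matrix.submatrix_apply, Fin.succAbove_last, Matrix.of_apply, hentry]
  · intro k _
    rw [hentry, h0, mul_zero, zero_mul]

/-- A Laurent monomial is a quotient of monomials off zero: `x ^ m = x ^ m⁺ / x ^ m⁻`.
[folklore] -/
theorem mpm_zpow_eq_div (x : ℝ) (hx : x ≠ 0) (m : ℤ) :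
    x ^ m = x ^ m.toNat / x ^ (-m).toNat := by
  rw [← zpow_natCast, ← zpow_natCast, ← zpow_sub₀ hx, Int.toNat_sub_toNat_neg]

/-- In logarithmic coordinates the matrix power map is linear:
`∏_j x_j^{M k j} = exp ((M · log x)_k)` on the open orthant. [folklore] -/
theorem mpm_prod_zpow_eq_exp {n : ℕ} (M : Matrix (Fin n) (Fin n) ℤ) {x : Fin n → ℝ}
    (hx : ∀ j, 0 < x j) (k : Fin n) :
    ∏ j, x j ^ (M k j) =
      Real.exp ((M.map fun a : ℤ => (a : ℝ)).mulVec (fun j => Real.log (x j)) k) := by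
  simp only [Matrix.mulVec, dotProduct, Matrix.map_apply, Real.exp_sum]
  refine Finset.prod_congr rfl fun j _ => ?_
  rw [← Real.rpow_intCast, Real.rpow_def_of_pos (hx j), mul_comm]

/-! ## The chart: injectivity, surjectivity, derivative, semialgebraicity -/

/-- The matrix power map is injective on `{x_j > 0}` when `det M ≠ 0`: in logarithmic coordinates
its box part is the injective linear map `M`, and the slack is then determined. [folklore] -/
theorem mpm_injOn {n : ℕ} (M : Matrix (Fin n) (Fin n) ℤ) (hM : M.det ≠ 0)
    (Φ : (Fin (n + 1) → ℝ) → (Fin (n + 1) → ℝ))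
    (hΦ1 : ∀ p (k : Fin n), Φ p (Fin.castSucc k) = ∏ j, p (Fin.castSucc j) ^ (M k j))
    (hΦ2 : ∀ p, Φ p (Fin.last n) =
      p (Fin.last n) * (∏ j, p (Fin.castSucc j)) / ∏ k, ∏ j, p (Fin.castSucc j) ^ (M k j)) :
    InjOn Φ {p | ∀ ι : Fin n, 0 < p (Fin.castSucc ι)} := by
  intro p hp q hq hpq
  have hunit : IsUnit (M.map fun a : ℤ => (a : ℝ)).det := by
    rw [← Int.cast_det]
    exact isUnit_iff_ne_zero.mpr (Int.cast_ne_zero.mpr hM)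
  have hlog : (fun j => Real.log (p (Fin.castSucc j))) = fun j => Real.log (q (Fin.castSucc j)) := by
    refine Matrix.mulVec_injective_iff_isUnit.mpr
      ((Matrix.isUnit_iff_isUnit_det _).mpr hunit) (funext fun k => ?_)
    have h := congr_fun hpq (Fin.castSucc k)
    rw [hΦ1, hΦ1, mpm_prod_zpow_eq_exp M hp, mpm_prod_zpow_eq_exp M hq] at h
    exact Real.exp_injective h
  have hx : ∀ j, p (Fin.castSucc j) = q (Fin.castSucc j) := fun j =>
    Real.log_injOn_pos (hp j) (hq j) (congr_fun hlog j)
  have hl := congr_fun hpq (Fin.last n)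
  rw [hΦ2, hΦ2] at hl
  simp_rw [hx] at hl
  have hA : ∏ j, q (Fin.castSucc j) ≠ 0 := Finset.prod_ne_zero_iff.mpr fun j _ => (hq j).ne'
  have hB : ∏ k, ∏ j, q (Fin.castSucc j) ^ (M k j) ≠ 0 := Finset.prod_ne_zero_iff.mpr fun k _ =>
    Finset.prod_ne_zero_iff.mpr fun j _ => zpow_ne_zero _ (hq j).ne'
  funext i
  cases i using Fin.lastCases with
  | last => exact mul_right_cancel₀ hA ((div_left_inj' hB).1 hl)
  | cast j => exact hx j

/-- The matrix power map is onto `{x_j > 0}` when `det M ≠ 0`: the preimage of `(x', z')` has box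
coordinates `exp (M⁻¹ · log x')` and slack `z' ∏ x' / ∏ x`. [folklore] -/
theorem mpm_surj {n : ℕ} (M : Matrix (Fin n) (Fin n) ℤ) (hM : M.det ≠ 0)
    (Φ : (Fin (n + 1) → ℝ) → (Fin (n + 1) → ℝ))
    (hΦ1 : ∀ p (k : Fin n), Φ p (Fin.castSucc k) = ∏ j, p (Fin.castSucc j) ^ (M k j))
    (hΦ2 : ∀ p, Φ p (Fin.last n) =
      p (Fin.last n) * (∏ j, p (Fin.castSucc j)) / ∏ k, ∏ j, p (Fin.castSucc j) ^ (M k j))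
    {q : Fin (n + 1) → ℝ} (hq : ∀ ι : Fin n, 0 < q (Fin.castSucc ι)) :
    ∃ p : Fin (n + 1) → ℝ, (∀ ι : Fin n, 0 < p (Fin.castSucc ι)) ∧ Φ p = q := by
  set A : Matrix (Fin n) (Fin n) ℝ := M.map fun a : ℤ => (a : ℝ) with hA
  have hunit : IsUnit A.det := by
    rw [hA, ← Int.cast_det]
    exact isUnit_iff_ne_zero.mpr (Int.cast_ne_zero.mpr hM)
  set w : Fin n → ℝ := fun k => Real.log (q (Fin.castSucc k)) with hw
  set x : Fin n → ℝ := fun j => Real.exp (A⁻¹.mulVec w j) with hx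
  have hx0 : ∀ j, 0 < x j := fun j => Real.exp_pos _
  have hv : (fun j => Real.log (x j)) = A⁻¹.mulVec w := funext fun j => Real.log_exp _
  have hkey : ∀ k, ∏ j, x j ^ (M k j) = q (Fin.castSucc k) := fun k => by
    rw [mpm_prod_zpow_eq_exp M hx0, hv]
    simp only [← hA, Matrix.mulVec_mulVec, Matrix.mul_nonsing_inv _ hunit, Matrix.one_mulVec, hw,
      Real.exp_log (hq k)]
  have hP : ∏ k, q (Fin.castSucc k) ≠ 0 := Finset.prod_ne_zero_iff.mpr fun k _ => (hq k).ne'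
  have hX : ∏ j, x j ≠ 0 := Finset.prod_ne_zero_iff.mpr fun j _ => (hx0 j).ne'
  refine ⟨Fin.snoc (α := fun _ => ℝ) x (q (Fin.last n) * (∏ k, q (Fin.castSucc k)) / ∏ j, x j),
    fun ι => by simpa only [Fin.snoc_castSucc] using hx0 ι, funext fun i => ?_⟩
  cases i using Fin.lastCases with
  | cast k =>
    rw [hΦ1]
    simp only [Fin.snoc_castSucc]
    exact hkey k
  | last =>
    rw [hΦ2]
    simp only [Fin.snoc_castSucc, Fin.snoc_last, hkey]
    rw [div_mul_cancel₀ _ hX, mul_div_cancel_right₀ _ hP]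

/-- **Derivative and Jacobian determinant of the matrix power map.** At every point with non-zero
box coordinates the chart is differentiable; its derivative has box block
`diag(x') · M · diag(x)⁻¹` (Leibniz rule on the Laurent monomials), slack column `(0, …, 0,
∏ x / ∏ x')`, hence determinant `det M`. [folklore] -/
theorem mpm_hasFDerivAt {n : ℕ} (M : Matrix (Fin n) (Fin n) ℤ)
    (Φ : (Fin (n + 1) → ℝ) → (Fin (n + 1) → ℝ))
    (hΦ1 : ∀ p (k : Fin n), Φ p (Fin.castSucc k) = ∏ j, p (Fin.castSucc j) ^ (M k j))
    (hΦ2 : ∀ p, Φ p (Fin.last n) =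
      p (Fin.last n) * (∏ j, p (Fin.castSucc j)) / ∏ k, ∏ j, p (Fin.castSucc j) ^ (M k j)) :
    ∃ Φ' : (Fin (n + 1) → ℝ) → (Fin (n + 1) → ℝ) →L[ℝ] (Fin (n + 1) → ℝ),
      ∀ p, (∀ ι : Fin n, 0 < p (Fin.castSucc ι)) →
        HasFDerivAt Φ (Φ' p) p ∧ (Φ' p).det = (M.det : ℝ) := by
  classical
  set π : (Fin (n + 1) → ℝ) →L[ℝ] (Fin n → ℝ) := ContinuousLinearMap.pi fun ι =>
    ContinuousLinearMap.proj (R := ℝ) (φ := fun _ : Fin (n + 1) => ℝ) (Fin.castSucc ι)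
  have hπ : ∀ p ι, π p ι = p (Fin.castSucc ι) := fun p ι => rfl
  -- the rows of the derivative of the box part (Leibniz form), the slack factor `G`
  set R : (Fin n → ℝ) → Fin n → (Fin n → ℝ) →L[ℝ] ℝ := fun x k =>
    ∑ i, (∏ j ∈ Finset.univ.erase i, x j ^ (M k j)) •
      (((M k i : ℝ) * x i ^ (M k i - 1)) •
        ContinuousLinearMap.proj (R := ℝ) (φ := fun _ : Fin n => ℝ) i) with hR
  set G : (Fin n → ℝ) → ℝ := fun x => (∏ j, x j) * (∏ k, ∏ j, x j ^ (M k j))⁻¹ with hG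
  set Rl : (Fin (n + 1) → ℝ) → (Fin (n + 1) → ℝ) →L[ℝ] ℝ := fun p =>
    p (Fin.last n) • (fderiv ℝ G (π p)).comp π +
      G (π p) • ContinuousLinearMap.proj (R := ℝ) (φ := fun _ : Fin (n + 1) => ℝ) (Fin.last n)
    with hRl
  refine ⟨fun p => ContinuousLinearMap.pi (Fin.snoc (α := fun _ => (Fin (n + 1) → ℝ) →L[ℝ] ℝ)
    (fun k => (R (π p) k).comp π) (Rl p)), fun p hp => ?_⟩
  have hp0 : ∀ j, π p j ≠ 0 := fun j => (hp j).ne'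
  have hz : ∀ k i, HasFDerivAt (fun x : Fin n → ℝ => x i ^ (M k i))
      (((M k i : ℝ) * π p i ^ (M k i - 1)) •
        ContinuousLinearMap.proj (R := ℝ) (φ := fun _ : Fin n => ℝ) i) (π p) := fun k i => by
    have h1 : HasFDerivAt (fun x : Fin n → ℝ => x i)
        (ContinuousLinearMap.proj (R := ℝ) (φ := fun _ : Fin n => ℝ) i) (π p) :=
      hasFDerivAt_apply i (π p)
    exact (hasDerivAt_zpow (M k i) (π p i) (Or.inl (hp0 i))).comp_hasFDerivAt (π p) h1
  have hrow : ∀ k, HasFDerivAt (fun x : Fin n → ℝ => ∏ j, x j ^ (M k j)) (R (π p) k) (π p) :=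
    fun k => HasFDerivAt.finsetProd fun i _ => hz k i
  have hY : ∏ k, ∏ j, π p j ^ (M k j) ≠ 0 := Finset.prod_ne_zero_iff.mpr fun k _ =>
    Finset.prod_ne_zero_iff.mpr fun j _ => zpow_ne_zero _ (hp0 j)
  have hX : ∏ j, π p j ≠ 0 := Finset.prod_ne_zero_iff.mpr fun j _ => hp0 j
  have hGd : DifferentiableAt ℝ G (π p) :=
    hasFDerivAt_finsetProd.differentiableAt.fun_mul
      ((HasFDerivAt.finsetProd fun k _ => hrow k).differentiableAt.inv hY)
  beta_reduce
  set L := ContinuousLinearMap.pi (Fin.snoc (α := fun _ => (Fin (n + 1) → ℝ) →L[ℝ] ℝ)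
    (fun k => (R (π p) k).comp π) (Rl p)) with hL
  constructor
  · rw [hL]
    refine hasFDerivAt_pi'' fun i => ?_
    rw [ContinuousLinearMap.proj_pi]
    cases i using Fin.lastCases with
    | last =>
      rw [Fin.snoc_last, show (fun q => Φ q (Fin.last n)) = fun q => q (Fin.last n) * (G ∘ π) q from
        funext fun q => by
          rw [hΦ2, mul_div_assoc, div_eq_mul_inv]
          simp only [hG, Function.comp_apply, hπ]]
      exact (hasFDerivAt_apply (Fin.last n) p).fun_mul (hGd.hasFDerivAt.comp p π.hasFDerivAt)
    | cast k =>
      rw [Fin.snoc_castSucc, show (fun q => Φ q (Fin.castSucc k)) =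
        (fun x : Fin n → ℝ => ∏ j, x j ^ (M k j)) ∘ π from funext fun q => hΦ1 q k]
      exact (hrow k).comp p π.hasFDerivAt
  · -- the entries of the matrix of `L`
    have hπl : π (Pi.single (Fin.last n) 1) = 0 := funext fun ι => by
      rw [hπ]
      exact Pi.single_eq_of_ne (Fin.castSucc_lt_last ι).ne _
    have hπc : ∀ j : Fin n, π (Pi.single (Fin.castSucc j) 1) = Pi.single j 1 := fun j =>
      funext fun ι => by
        rw [hπ]
        rcases eq_or_ne ι j with rfl | h
        · rw [Pi.single_eq_same, Pi.single_eq_same]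
        · rw [Pi.single_eq_of_ne h, Pi.single_eq_of_ne (fun e => h (Fin.castSucc_injective _ e))]
    have e1 : ∀ k : Fin n, L (Pi.single (Fin.last n) 1) (Fin.castSucc k) = 0 := fun k => by
      rw [hL, ContinuousLinearMap.pi_apply, Fin.snoc_castSucc, ContinuousLinearMap.comp_apply, hπl,
        map_zero]
    have e2 : L (Pi.single (Fin.last n) 1) (Fin.last n) = G (π p) := by
      rw [hL, ContinuousLinearMap.pi_apply, Fin.snoc_last]
      simp only [hRl, _root_.add_apply, _root_.smul_apply, ContinuousLinearMap.comp_apply, hπl,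
        map_zero, ContinuousLinearMap.proj_apply, Pi.single_eq_same, smul_eq_mul, mul_zero,
        zero_add, mul_one]
    have e3 : ∀ k j : Fin n, L (Pi.single (Fin.castSucc j) 1) (Fin.castSucc k) =
        (∏ j', π p j' ^ (M k j')) * ((M k j : ℝ) * (π p j)⁻¹) := fun k j => by
      rw [hL, ContinuousLinearMap.pi_apply, Fin.snoc_castSucc, ContinuousLinearMap.comp_apply, hπc]
      simp only [hR, _root_.sum_apply, _root_.smul_apply, ContinuousLinearMap.proj_apply,
        Pi.single_apply, smul_eq_mul, mul_ite, mul_one, mul_zero, Finset.sum_ite_eq',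
        Finset.mem_univ, if_true]
      rw [zpow_sub_one₀ (hp0 j),
        ← Finset.prod_erase_mul Finset.univ (fun j' => π p j' ^ (M k j')) (Finset.mem_univ j)]
      ring
    have hblock : (Matrix.of fun k j : Fin n => L (Pi.single (Fin.castSucc j) 1) (Fin.castSucc k)) =
        Matrix.diagonal (fun k => ∏ j', π p j' ^ (M k j')) * (M.map fun a : ℤ => (a : ℝ)) *
          Matrix.diagonal fun j => (π p j)⁻¹ := by
      ext k j
      rw [Matrix.of_apply, e3, Matrix.mul_diagonal, Matrix.diagonal_mul, Matrix.map_apply, mul_assoc]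
    rw [mpm_det_lastCol L e1, e2, hblock, Matrix.det_mul, Matrix.det_mul, Matrix.det_diagonal,
      Matrix.det_diagonal, ← Int.cast_det, Finset.prod_inv_distrib]
    simp only [hG]
    field_simp

/-- The matrix power map is `ℚ`-semialgebraic on every `ℚ`-semialgebraic set off the coordinate
hyperplanes of the box: each coordinate is a quotient of monomials (`x ^ m = x ^ m⁺ / x ^ m⁻`).
[Bochnak–Coste–Roy 1998, §2.2] [folklore] -/
theorem mpm_isSemialgebraicMapOn {n : ℕ} (M : Matrix (Fin n) (Fin n) ℤ)
    (Φ : (Fin (n + 1) → ℝ) → (Fin (n + 1) → ℝ))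
    (hΦ1 : ∀ p (k : Fin n), Φ p (Fin.castSucc k) = ∏ j, p (Fin.castSucc j) ^ (M k j))
    (hΦ2 : ∀ p, Φ p (Fin.last n) =
      p (Fin.last n) * (∏ j, p (Fin.castSucc j)) / ∏ k, ∏ j, p (Fin.castSucc j) ^ (M k j))
    {σ : Set (Fin (n + 1) → ℝ)} (hσ : IsSemialgebraic ℚ σ)
    (h0 : ∀ p ∈ σ, ∀ ι : Fin n, p (Fin.castSucc ι) ≠ 0) : IsSemialgebraicMapOn ℚ σ Φ := by
  have hsplit : ∀ p ∈ σ, ∀ k, ∏ j, p (Fin.castSucc j) ^ (M k j) =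
      (∏ j, p (Fin.castSucc j) ^ (M k j).toNat) / ∏ j, p (Fin.castSucc j) ^ (-M k j).toNat :=
    fun p hp k => by
      rw [← Finset.prod_div_distrib]
      exact Finset.prod_congr rfl fun j _ => mpm_zpow_eq_div _ (h0 p hp j) _
  refine IsSemialgebraicMapOn.of_forall hσ fun i => ?_
  cases i using Fin.lastCases with
  | last =>
    have hq : ∀ p ∈ σ, aeval p (∏ k, ∏ j,
        (X (Fin.castSucc j) : MvPolynomial (Fin (n + 1)) ℚ) ^ (M k j).toNat) ≠ (0 : ℝ) :=
      fun p hp => by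
        simp only [map_prod, map_pow, aeval_X]
        exact Finset.prod_ne_zero_iff.mpr fun k _ =>
          Finset.prod_ne_zero_iff.mpr fun j _ => pow_ne_zero _ (h0 p hp j)
    refine (isSemialgebraicFunOn_aeval_div_aeval hσ (X (Fin.last n) *
      (∏ j, (X (Fin.castSucc j) : MvPolynomial (Fin (n + 1)) ℚ)) *
        ∏ k, ∏ j, (X (Fin.castSucc j) : MvPolynomial (Fin (n + 1)) ℚ) ^ (-M k j).toNat) _ hq).congr
      fun p hp => ?_
    simp only [map_mul, map_prod, map_pow, aeval_X, hΦ2]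
    rw [Finset.prod_congr rfl fun k _ => hsplit p hp k, Finset.prod_div_distrib, div_div_eq_mul_div]
  | cast k =>
    have hq : ∀ p ∈ σ, aeval p (∏ j,
        (X (Fin.castSucc j) : MvPolynomial (Fin (n + 1)) ℚ) ^ (-M k j).toNat) ≠ (0 : ℝ) :=
      fun p hp => by
        simp only [map_prod, map_pow, aeval_X]
        exact Finset.prod_ne_zero_iff.mpr fun j _ => pow_ne_zero _ (h0 p hp j)
    exact (isSemialgebraicFunOn_aeval_div_aeval hσ
      (∏ j, (X (Fin.castSucc j) : MvPolynomial (Fin (n + 1)) ℚ) ^ (M k j).toNat) _ hq).congr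
      fun p hp => by simp only [map_prod, map_pow, aeval_X, hΦ1, hsplit p hp k]

/-- The open region `{x_j > 0}` (no condition on the slack) is `ℚ`-semialgebraic. [folklore] -/
theorem mpm_isSemialgebraic_pos {n : ℕ} :
    IsSemialgebraic ℚ {p : Fin (n + 1) → ℝ | ∀ ι : Fin n, 0 < p (Fin.castSucc ι)} := by
  convert IsSemialgebraic.biInter (Finset.univ : Finset (Fin n))
    (fun ι => {p : Fin (n + 1) → ℝ |
      0 < aeval p (X (Fin.castSucc ι) : MvPolynomial (Fin (n + 1)) ℚ)})
    fun ι _ => isSemialgebraic_setOf_eval_pos _ using 1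
  ext p
  simp [aeval_X]

/-! ## The move -/

/-- **The matrix power move, for an abstract chart** `Φ` with the coordinates of `Φ_M`: (i) the
pulled-back integrand-`1` representation on `{p ∈ Q | Φ p ∈ σ'}` exists; (ii) membership
transport inside `Q = {x_j > 0}` gives `[r'] − |det M| • [r] ∈ KZ.relations` (one rule-(2) move
from `|det M| · r`, plus rule (1b)). [Kontsevich–Zagier 2001, §1.2, rules (1b), (2)] -/
theorem mpm_main {n : ℕ} (M : Matrix (Fin n) (Fin n) ℤ) (hM : M.det ≠ 0)
    (Φ : (Fin (n + 1) → ℝ) → (Fin (n + 1) → ℝ))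
    (hΦ1 : ∀ p (k : Fin n), Φ p (Fin.castSucc k) = ∏ j, p (Fin.castSucc j) ^ (M k j))
    (hΦ2 : ∀ p, Φ p (Fin.last n) =
      p (Fin.last n) * (∏ j, p (Fin.castSucc j)) / ∏ k, ∏ j, p (Fin.castSucc j) ^ (M k j)) :
    (∀ r' : KZ.IntegralRep (n + 1), r'.domain ⊆ {p | ∀ ι : Fin n, 0 < p (Fin.castSucc ι)} →
      (∀ p ∈ r'.domain, r'.integrand p = 1) →
      ∃ r : KZ.IntegralRep (n + 1), r.domain = {p : Fin (n + 1) → ℝ |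
        (∀ ι : Fin n, 0 < p (Fin.castSucc ι)) ∧ Φ p ∈ r'.domain} ∧ r.integrand = fun _ => 1) ∧
    (∀ r r' : KZ.IntegralRep (n + 1), r.domain ⊆ {p | ∀ ι : Fin n, 0 < p (Fin.castSucc ι)} →
      r'.domain ⊆ {p | ∀ ι : Fin n, 0 < p (Fin.castSucc ι)} →
      (∀ p : Fin (n + 1) → ℝ, (∀ ι : Fin n, 0 < p (Fin.castSucc ι)) →
        (p ∈ r.domain ↔ Φ p ∈ r'.domain)) →
      (∀ p ∈ r.domain, r.integrand p = 1) → (∀ p ∈ r'.domain, r'.integrand p = 1) →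
      KZ.of r' - M.det.natAbs • KZ.of r ∈ KZ.relations) := by
  classical
  obtain ⟨Φ', hΦ'⟩ := mpm_hasFDerivAt M Φ hΦ1 hΦ2
  have hinj := mpm_injOn M hM Φ hΦ1 hΦ2
  have hdet : ∀ p : Fin (n + 1) → ℝ, (∀ ι : Fin n, 0 < p (Fin.castSucc ι)) →
      |(Φ' p).det| = (M.det.natAbs : ℝ) := fun p hp => by
    rw [(hΦ' p hp).2, Nat.cast_natAbs, Int.cast_abs]
  constructor
  · intro r' hr' hf'
    set D := {p : Fin (n + 1) → ℝ | (∀ ι : Fin n, 0 < p (Fin.castSucc ι)) ∧ Φ p ∈ r'.domain}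
      with hD
    have hDQ : D ⊆ {p | ∀ ι : Fin n, 0 < p (Fin.castSucc ι)} := fun p hp => hp.1
    have hDsa : IsSemialgebraic ℚ D := PlanarSAZylev.teCalc_isSemialgebraic_preimage
      (mpm_isSemialgebraicMapOn M Φ hΦ1 hΦ2 mpm_isSemialgebraic_pos fun p hp ι => (hp ι).ne')
      r'.isSemialgebraic_domain
    have hDm : MeasurableSet D := IsSemialgebraic.measurableSet_holds hDsa
    have himg : Φ '' D = r'.domain := by
      refine Subset.antisymm ?_ fun q hq => ?_
      · rintro _ ⟨p, hp, rfl⟩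
        exact hp.2
      · obtain ⟨p, hp, rfl⟩ := mpm_surj M hM Φ hΦ1 hΦ2 (hr' hq)
        exact ⟨p, ⟨hp, hq⟩, rfl⟩
    have h1 : IntegrableOn (fun _ => (1 : ℝ)) (Φ '' D) := by
      rw [himg]
      exact r'.integrableOn.congr_fun hf' (KZ.IntegralRep.measurableSet_domain_holds r')
    have h2 := (integrableOn_image_iff_integrableOn_abs_det_fderiv_smul volume hDm
      (fun p hp => (hΦ' p hp.1).1.hasFDerivWithinAt) (hinj.mono hDQ) _).mp h1
    have h3 : IntegrableOn (fun _ => (M.det.natAbs : ℝ)) D :=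
      h2.congr_fun (fun p hp => by
        show |(Φ' p).det| • (1 : ℝ) = _
        rw [smul_eq_mul, mul_one, hdet p hp.1]) hDm
    have hc : (M.det.natAbs : ℝ) ≠ 0 := Nat.cast_ne_zero.mpr (Int.natAbs_ne_zero.mpr hM)
    have h4 : IntegrableOn (fun _ => (1 : ℝ)) D := by
      have h5 := Integrable.const_mul h3 (M.det.natAbs : ℝ)⁻¹
      simp only [inv_mul_cancel₀ hc] at h5
      exact h5
    have hone : IsSemialgebraicFunOn ℚ D fun _ => (1 : ℝ) := by
      simpa using isSemialgebraicFunOn_aeval hDsa (1 : MvPolynomial (Fin (n + 1)) ℚ)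
    exact ⟨⟨D, fun _ => 1, hDsa, hone, h4⟩, rfl, rfl⟩
  · intro r r' hr hr' hmem hf hf'
    have himg : r'.domain = Φ '' r.domain := by
      refine Subset.antisymm (fun q hq => ?_) ?_
      · obtain ⟨p, hp, rfl⟩ := mpm_surj M hM Φ hΦ1 hΦ2 (hr' hq)
        exact ⟨p, (hmem p hp).2 hq, rfl⟩
      · rintro _ ⟨p, hp, rfl⟩
        exact (hmem p (hr hp)).1 hp
    have hcov : KZ.of (r.constMul ((M.det.natAbs : ℕ) : ℝ) (isAlgebraic_nat _)) - KZ.of r' ∈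
        KZ.changeOfVariablesRel := by
      refine ⟨n + 1, r.constMul ((M.det.natAbs : ℕ) : ℝ) (isAlgebraic_nat _), r', Φ, Φ',
        mpm_isSemialgebraicMapOn M Φ hΦ1 hΦ2 r.isSemialgebraic_domain fun p hp ι => (hr hp ι).ne',
        fun p hp => (hΦ' p (hr hp)).1.hasFDerivWithinAt, hinj.mono hr, himg, fun p hp => ?_, rfl⟩
      have hp' : p ∈ r.domain := hp
      show (M.det.natAbs : ℝ) * r.integrand p = r'.integrand (Φ p) * |(Φ' p).det|
      rw [hf p hp', hf' _ (himg ▸ mem_image_of_mem Φ hp'), hdet p (hr hp'), mul_one, one_mul]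
    have key := KZ.relations.sub_mem
      (KZ.IntegralRep.of_constMul_nat_sub_nsmul_mem_relations r M.det.natAbs)
      (KZ.changeOfVariablesRel_subset_relations hcov)
    rwa [sub_sub_sub_cancel_left] at key

/-- **The matrix power move** (stub `stub_matrixPowerMove` of `VolumeFormOffPlane`, line `Sketch`,
stmt-KontsevichZagierPeriods-14935). For `M : Matrix (Fin n) (Fin n) ℤ` with `det M ≠ 0`, the map
`Φ_M (p) = ((∏_j x_j^{M k j})_k, z · ∏_j x_j / ∏_k ∏_j x_j^{M k j})` is a `ℚ`-semialgebraic
differentiable bijection of `{x_ι > 0}` with Jacobian determinant the constant `det M` (in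
logarithmic coordinates it is linear); (i) integrand-`1` representations pull back along it,
(ii) ONE rule-(2) move from `|det M| · r` plus integrand additivity give
`[r'] − |det M| • [r] ∈ KZ.relations` under membership transport.
[Kontsevich–Zagier 2001, §1.2, rules (1b), (2)] -/
theorem stub_matrixPowerMove : (∀ (n : ℕ) (M : Matrix (Fin n) (Fin n) ℤ), M.det ≠ 0 → (∀ (r' : KZ.IntegralRep (n + 1)), r'.domain ⊆ {p | ∀ ι : Fin (n), 0 < p (Fin.castSucc ι)} → (∀ p ∈ r'.domain, r'.integrand p = 1) → ∃ r : KZ.IntegralRep (n + 1), r.domain = {p : Fin (n + 1) → ℝ | (∀ ι : Fin n, 0 < p (Fin.castSucc ι)) ∧ (Fin.snoc (fun k : Fin (n) => ∏ j : Fin (n), p (Fin.castSucc j) ^ (M k j)) (p (Fin.last (n)) * (∏ j : Fin (n), p (Fin.castSucc j)) / ∏ k : Fin (n), ∏ j : Fin (n), p (Fin.castSucc j) ^ (M k j)) : Fin ((n) + 1) → ℝ) ∈ r'.domain} ∧ r.integrand = fun _ => 1) ∧ (∀ (r r' : KZ.IntegralRep (n + 1)), r.domain ⊆ {p | ∀ ι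 : Fin (n), 0 < p (Fin.castSucc ι)} → r'.domain ⊆ {p | ∀ ι : Fin (n), 0 < p (Fin.castSucc ι)} → (∀ p : Fin (n + 1) → ℝ, (∀ ι : Fin n, 0 < p (Fin.castSucc ι)) → (p ∈ r.domain ↔ (Fin.snoc (fun k : Fin (n) => ∏ j : Fin (n), p (Fin.castSucc j) ^ (M k j)) (p (Fin.last (n)) * (∏ j : Fin (n), p (Fin.castSucc j)) / ∏ k : Fin (n), ∏ j : Fin (n), p (Fin.castSucc j) ^ (M k j)) : Fin ((n) + 1) → ℝ) ∈ r'.domain)) → (∀ p ∈ r.domain, r.integrand p = 1) → (∀ p ∈ r'.domain, r'.integrand p = 1) → KZ.of r' - M.det.natAbs • KZ.of r ∈ KZ.relations)) := by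
  intro n M hM
  exact mpm_main M hM (fun p => Fin.snoc (α := fun _ : Fin (n + 1) => ℝ)
      (fun k : Fin n => ∏ j : Fin n, p (Fin.castSucc j) ^ (M k j))
      (p (Fin.last n) * (∏ j : Fin n, p (Fin.castSucc j)) /
        ∏ k : Fin n, ∏ j : Fin n, p (Fin.castSucc j) ^ (M k j)))
    (fun p k => by simp only [Fin.snoc_castSucc]) fun p => by simp only [Fin.snoc_last]

end Summit.KontsevichZagierPeriods.SymplecticScissors.LogPolytope

end
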